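import Literature.AlgebraicGeometry.Modules.SerreTwistSegreClass
import Literature.AlgebraicGeometry.Modules.HilbertLetterTransport
import Literature.AlgebraicGeometry.Morphisms.ProjectiveSpaceSegreVeronese
import HarnessLib

/-!
# `𝒪(1)` of the Segre embedding OVER A BASE: for `Y`-embeddings `j₁ : Y₁ → 𝐏(ι; Y)`, `j₂ : Y₂ → 𝐏(κ; Y)`, the product embedding
# `Y₁ ×_Y Y₂ → 𝐏(ι; Y) ×_Y 𝐏(κ; Y) → 𝐏(τ; Y)` has `𝒪(1) ≅ pr₁^*𝒪_{j₁}(1) ⊗ pr₂^*𝒪_{j₂}(1)` ([Hartshorne1977] II Ex. 5.11, 5.12 (b))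

Layer `Literature/AlgebraicGeometry/Modules`, namespace `Literature.AlgebraicGeometry.Modules.SerreTwist`.  THEOREMS ONLY (no definition, no named
fact, no instance, no notation, no `sorry`); universe `0` (the universe of ★ `Morphisms.segreOver`'s consumers).  Cell `hodgecm-mathlib` (D-0151), P6
«MOD programme», organ «stub_ILET» FILE B1 (B-p10 (g29); A-p14 (g34) road 23:07:17Z: «the two generic sub-lemmas are `prodEmb^*𝒪(1) ≅ pr₁^*𝒪_{j₁}(1)
⊗ pr₂^*𝒪_{j₂}(1)` in `twistMod` form and letter transport» — the second is ★ `Modules/HilbertLetterTransport`).  The line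
`Cruxes/HLiu418/Lines/F0_P6a_IsomSchemeFiniteType.lean` defines `prodEmb Y₁ Y₂ j₁ hj₁ j₂ hj₂ := ((Over.homMk j₁ hj₁ ⊗ₘ Over.homMk j₂ hj₂) ≫
segreOver Y ε).left`; this file computes the Serre twist `𝒪(1)` along `prodEmb ≫ pr₂ : Y₁ ×_Y Y₂ → 𝐏ⁿ_ℤ` WITHOUT importing the line (the term is
spelled out).  Count-neutral: HC_CM is proved only modulo the printed citations until rung 0 closes.

THE MATHEMATICS ([Hartshorne1977] II Ex. 5.11: the Segre embedding `z_{ij} = x_i y_j` has `ψ^*𝒪(1) ≅ p₁^*𝒪(1) ⊗ p₂^*𝒪(1)`; II Prop. 5.12 (b)(c)).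
★ `detClass_serreTwist_segre` (any `L : X → 𝐏ᵃ_A ×_A 𝐏ᵇ_A`, classes of `𝒪(−m)` in `Ȟ¹(X, 𝒪^×)`) is moved to ★ `Morphisms.segreOver` (the base
change to `Y` of the Segre map over `ℤ`: `(segreOver Y ε).left ≫ pr₂ = prodToInt ≫ Segre.segre ℤ ε`, ★ `segreOver_left_snd`) at
`L := (j₁ ⊗ j₂).left ≫ prodToInt`, whose two components are `pr₁ ≫ j₁ ≫ pr₂` and `pr₂ ≫ j₂ ≫ pr₂` (Mathlib `Over.tensorHom_left_fst/_snd`, ★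
`prodToInt_fst/_snd`); classes pull back (★ `detClass_serreTwist_comp`), `𝒪(m) = 𝒪(−m)^∨` (★ `sheafHomTwistIso`, ★ `detClass_dual`), and rank-one
modules with equal classes are isomorphic (★ `nonempty_iso_iff_detClass_eq`, ★ `detClass_tensorObj_of_hasRank_one`, ★ `detClass_pullback`).

* §1 `detClass_twistMod_prodSegre` — the class identity `[𝒪_{σ}(m)] = pr₁^*[𝒪_{j₁}(m)] · pr₂^*[𝒪_{j₂}(m)]`.
* §2 **`nonempty_twistMod_prodSegre_iso_tensorObj`** — `𝒪_σ(m) ≅ pr₁^*𝒪_{j₁}(m) ⊗ pr₂^*𝒪_{j₂}(m)`; **`nonempty_twistMod_prodSegre_one_iso_of_iso`** —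
  with `𝒪_{jᵢ}(1) ≅ Nᵢ`: `𝒪_σ(1) ≅ pr₁^*N₁ ⊗ pr₂^*N₂`.

## References
* [Hartshorne1977] R. Hartshorne, *Algebraic Geometry* (1977), II Ex. 5.11 (p. 125), II Ex. 5.12 (b), II Prop. 5.12 (b)(c) (p. 117), III Ex. 4.5.
* [GortzWedhorn2020] U. Görtz, T. Wedhorn, *Algebraic Geometry I*, 2nd ed. (2020), (4.14) (pp. 114–115), (13.8).
* [StacksProject] The Stacks Project, Tags 01WD, 01NF.
-/

noncomputable section

-- `TopCat.Presheaf`/`Scheme.Modules` bookkeeping (as in ★ `Modules/SerreTwistSegreClass`).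
set_option backward.isDefEq.respectTransparency false

open CategoryTheory CategoryTheory.Limits CategoryTheory.Abelian AlgebraicGeometry TopologicalSpace Opposite MonoidalCategory

namespace Literature.AlgebraicGeometry.Modules

namespace SerreTwist

open Literature.AlgebraicGeometry.Morphisms Literature.AlgebraicGeometry.Morphisms.ProjCech Literature.AlgebraicGeometry.Motives

variable {ι κ τ : Type} {Y : Scheme.{0}} (ε : Fin (Nat.card ι + 1) × Fin (Nat.card κ + 1) ≃ Fin (Nat.card τ + 1))
  (Y₁ Y₂ : Over Y)
  (j₁ : Y₁.left ⟶ Morphisms.projectiveSpace ι Y) (hj₁ : j₁ ≫ Morphisms.projectiveSpaceFst ι Y = Y₁.hom)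
  (j₂ : Y₂.left ⟶ Morphisms.projectiveSpace κ Y) (hj₂ : j₂ ≫ Morphisms.projectiveSpaceFst κ Y = Y₂.hom)

/-! ## §1 The class identity -/

/-- The `𝐏ⁿ_ℤ`-component of the product embedding is the Segre map over `ℤ` after `(j₁ ⊗ j₂) ≫ prodToInt`. [cite: StacksProject, Tag 01WD] -/
theorem prodSegre_comp_snd :
    ((Over.homMk j₁ hj₁ ⊗ₘ Over.homMk j₂ hj₂ :
        Y₁ ⊗ Y₂ ⟶ Over.mk (Morphisms.projectiveSpaceFst ι Y) ⊗ Over.mk (Morphisms.projectiveSpaceFst κ Y)) ≫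
        Morphisms.segreOver Y ε).left ≫ pullback.snd (terminal.from Y) (terminal.from (Morphisms.projectiveSpaceInt τ)) =
      ((Over.homMk j₁ hj₁ ⊗ₘ Over.homMk j₂ hj₂ :
        Y₁ ⊗ Y₂ ⟶ Over.mk (Morphisms.projectiveSpaceFst ι Y) ⊗ Over.mk (Morphisms.projectiveSpaceFst κ Y)).left ≫
        Morphisms.prodToInt ι κ Y) ≫ Segre.segre intU.{0} ε := by
  rw [Over.comp_left, Category.assoc, Morphisms.segreOver_left_snd, Category.assoc]

/-- The first component: `((j₁ ⊗ j₂) ≫ prodToInt) ≫ p₁ = pr₁ ≫ j₁ ≫ pr₂`. [cite: StacksProject, Tag 01NF] -/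
theorem prodToInt_comp_fst :
    (((Over.homMk j₁ hj₁ ⊗ₘ Over.homMk j₂ hj₂ :
        Y₁ ⊗ Y₂ ⟶ Over.mk (Morphisms.projectiveSpaceFst ι Y) ⊗ Over.mk (Morphisms.projectiveSpaceFst κ Y)).left ≫
        Morphisms.prodToInt ι κ Y) ≫ pullback.fst _ _ : (Y₁ ⊗ Y₂).left ⟶ PP intU.{0} (Nat.card ι)) =
      pullback.fst Y₁.hom Y₂.hom ≫ j₁ ≫ pullback.snd (terminal.from Y) (terminal.from (Morphisms.projectiveSpaceInt ι)) := by
  rw [Category.assoc, Morphisms.prodToInt_fst, ← Category.assoc, Over.tensorHom_left_fst, Category.assoc]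
  rfl

/-- The second component: `((j₁ ⊗ j₂) ≫ prodToInt) ≫ p₂ = pr₂ ≫ j₂ ≫ pr₂`. [cite: StacksProject, Tag 01NF] -/
theorem prodToInt_comp_snd :
    (((Over.homMk j₁ hj₁ ⊗ₘ Over.homMk j₂ hj₂ :
        Y₁ ⊗ Y₂ ⟶ Over.mk (Morphisms.projectiveSpaceFst ι Y) ⊗ Over.mk (Morphisms.projectiveSpaceFst κ Y)).left ≫
        Morphisms.prodToInt ι κ Y) ≫ pullback.snd _ _ : (Y₁ ⊗ Y₂).left ⟶ PP intU.{0} (Nat.card κ)) =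
      pullback.snd Y₁.hom Y₂.hom ≫ j₂ ≫ pullback.snd (terminal.from Y) (terminal.from (Morphisms.projectiveSpaceInt κ)) := by
  rw [Category.assoc, Morphisms.prodToInt_snd, ← Category.assoc, Over.tensorHom_left_snd, Category.assoc]
  rfl

/-- `[𝒪_X(m)]_φ = [𝒪_X(−m)]_φ⁻¹` for any `φ : X → 𝐏ʳ_A` (★ `sheafHomTwistIso`, ★ `detClass_dual`). [cite: Hartshorne1977, II Prop. 5.12 (b) (p. 117)] -/
theorem detClass_twistMod_unitModule_eq_inv {A : Type} [CommRing A] {r : ℕ} {X : Scheme.{0}} (φ : X ⟶ PP A r) (m : ℕ) :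
    detClass (isFiniteLocallyFree_twistMod_unitModule φ m) = (detClass (isFiniteLocallyFree_serreTwist φ m))⁻¹ := by
  rw [← detClass_dual (isFiniteLocallyFree_serreTwist φ m)]
  exact detClass_eq_of_iso (sheafHomTwistIso φ (unitModule X) m).symm _ _

/-- Equal morphisms to `𝐏ʳ` have Serre twists with equal classes. [folklore] -/
private theorem detClass_serreTwist_congr_of_eq {X : Scheme.{0}} {r : ℕ} {φ ψ : X ⟶ PP intU.{0} r} (h : φ = ψ) (m : ℕ) :
    detClass (isFiniteLocallyFree_serreTwist φ m) = detClass (isFiniteLocallyFree_serreTwist ψ m) := by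
  subst h; rfl

/-- **`[𝒪_σ(m)] = pr₁^*[𝒪_{j₁}(m)] · pr₂^*[𝒪_{j₂}(m)]` in `Ȟ¹(Y₁ ×_Y Y₂, 𝒪^×)`** for the product embedding
`σ = ((j₁ ⊗ j₂) ≫ segreOver Y ε).left` ([Hartshorne1977] II Ex. 5.11 over `ℤ`, base-changed: ★ `detClass_serreTwist_segre` at
`L := (j₁ ⊗ j₂).left ≫ prodToInt`, ★ `detClass_serreTwist_comp`). [cite: Hartshorne1977, II Ex. 5.11 (p. 125)] [cite: StacksProject, Tag 01WD] -/
theorem detClass_twistMod_prodSegre (m : ℕ) :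
    detClass (isFiniteLocallyFree_twistMod_unitModule
      (((Over.homMk j₁ hj₁ ⊗ₘ Over.homMk j₂ hj₂ :
          Y₁ ⊗ Y₂ ⟶ Over.mk (Morphisms.projectiveSpaceFst ι Y) ⊗ Over.mk (Morphisms.projectiveSpaceFst κ Y)) ≫
          Morphisms.segreOver Y ε).left ≫ pullback.snd (terminal.from Y) (terminal.from (Morphisms.projectiveSpaceInt τ))) m) =
      CechPic.pullback (pullback.fst Y₁.hom Y₂.hom) (detClass (isFiniteLocallyFree_twistMod_unitModule
          (j₁ ≫ pullback.snd (terminal.from Y) (terminal.from (Morphisms.projectiveSpaceInt ι))) m)) *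
        CechPic.pullback (pullback.snd Y₁.hom Y₂.hom) (detClass (isFiniteLocallyFree_twistMod_unitModule
          (j₂ ≫ pullback.snd (terminal.from Y) (terminal.from (Morphisms.projectiveSpaceInt κ))) m)) := by
  rw [detClass_twistMod_unitModule_eq_inv, detClass_twistMod_unitModule_eq_inv, detClass_twistMod_unitModule_eq_inv,
    map_inv, map_inv, ← mul_inv]
  congr 1
  have hσ := prodSegre_comp_snd ε Y₁ Y₂ j₁ hj₁ j₂ hj₂
  have key := detClass_serreTwist_segre (e := ε)
    (L := ((Over.homMk j₁ hj₁ ⊗ₘ Over.homMk j₂ hj₂ :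
        Y₁ ⊗ Y₂ ⟶ Over.mk (Morphisms.projectiveSpaceFst ι Y) ⊗ Over.mk (Morphisms.projectiveSpaceFst κ Y)).left ≫
        Morphisms.prodToInt ι κ Y)) m
  have k₁ := (detClass_serreTwist_congr_of_eq (prodToInt_comp_fst Y₁ Y₂ j₁ hj₁ j₂ hj₂) m).trans
    (detClass_serreTwist_comp (pullback.fst Y₁.hom Y₂.hom)
      (j₁ ≫ pullback.snd (terminal.from Y) (terminal.from (Morphisms.projectiveSpaceInt ι))) m)
  have k₂ := (detClass_serreTwist_congr_of_eq (prodToInt_comp_snd Y₁ Y₂ j₁ hj₁ j₂ hj₂) m).trans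
    (detClass_serreTwist_comp (pullback.snd Y₁.hom Y₂.hom)
      (j₂ ≫ pullback.snd (terminal.from Y) (terminal.from (Morphisms.projectiveSpaceInt κ))) m)
  rw [k₁, k₂] at key
  exact (detClass_serreTwist_congr_of_eq hσ m).trans key

/-! ## §2 The isomorphisms -/

/-- **`𝒪_σ(m) ≅ pr₁^*𝒪_{j₁}(m) ⊗ pr₂^*𝒪_{j₂}(m)`** on `Y₁ ×_Y Y₂` for the product embedding `σ = ((j₁ ⊗ j₂) ≫ segreOver Y ε).left`
(rank-one modules with equal classes, §1). [cite: Hartshorne1977, II Ex. 5.11 (p. 125) and II Ex. 5.12 (b)] -/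
theorem nonempty_twistMod_prodSegre_iso_tensorObj (m : ℕ) :
    Nonempty (twistMod (((Over.homMk j₁ hj₁ ⊗ₘ Over.homMk j₂ hj₂ :
          Y₁ ⊗ Y₂ ⟶ Over.mk (Morphisms.projectiveSpaceFst ι Y) ⊗ Over.mk (Morphisms.projectiveSpaceFst κ Y)) ≫
          Morphisms.segreOver Y ε).left ≫ pullback.snd (terminal.from Y) (terminal.from (Morphisms.projectiveSpaceInt τ)))
        (unitModule _) m ≅
      tensorObj
        ((Scheme.Modules.pullback (pullback.fst Y₁.hom Y₂.hom)).obj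
          (twistMod (j₁ ≫ pullback.snd (terminal.from Y) (terminal.from (Morphisms.projectiveSpaceInt ι))) (unitModule _) m))
        ((Scheme.Modules.pullback (pullback.snd Y₁.hom Y₂.hom)).obj
          (twistMod (j₂ ≫ pullback.snd (terminal.from Y) (terminal.from (Morphisms.projectiveSpaceInt κ))) (unitModule _) m))) := by
  refine (nonempty_iso_iff_detClass_eq (hasRank_twistMod_unitModule _ m)
    (hasRank_tensorObj_one (hasRank_pullback _ (hasRank_twistMod_unitModule _ m)) (hasRank_pullback _ (hasRank_twistMod_unitModule _ m)))
    (isFiniteLocallyFree_twistMod_unitModule _ m)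
    (isFiniteLocallyFree_tensorObj _ _ ((isFiniteLocallyFree_twistMod_unitModule _ m).pullback _)
      ((isFiniteLocallyFree_twistMod_unitModule _ m).pullback _))).2 ?_
  rw [detClass_twistMod_prodSegre, detClass_tensorObj_of_hasRank_one (hasRank_pullback _ (hasRank_twistMod_unitModule _ m))
    (hasRank_pullback _ (hasRank_twistMod_unitModule _ m)) ((isFiniteLocallyFree_twistMod_unitModule _ m).pullback _)
    ((isFiniteLocallyFree_twistMod_unitModule _ m).pullback _),
    detClass_pullback (hE := isFiniteLocallyFree_twistMod_unitModule _ m),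
    detClass_pullback (hE := isFiniteLocallyFree_twistMod_unitModule _ m)]
  rfl

/-- **`𝒪_σ(1) ≅ pr₁^*N₁ ⊗ pr₂^*N₂`** whenever `𝒪_{j₁}(1) ≅ N₁` and `𝒪_{j₂}(1) ≅ N₂` (the line's binders `eᵢ : 𝒪_{jᵢ}(1) ≅ L^Δ(λᵢ)^{⊗k}`).
[cite: Hartshorne1977, II Ex. 5.11 (p. 125) and II Ex. 5.12 (b)] -/
theorem nonempty_twistMod_prodSegre_one_iso_of_iso {N₁ : Y₁.left.Modules} {N₂ : Y₂.left.Modules}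
    (hN₁ : HasRank N₁ 1) (hN₂ : HasRank N₂ 1)
    (ψ₁ : twistMod (j₁ ≫ pullback.snd (terminal.from Y) (terminal.from (Morphisms.projectiveSpaceInt ι))) (unitModule _) 1 ≅ N₁)
    (ψ₂ : twistMod (j₂ ≫ pullback.snd (terminal.from Y) (terminal.from (Morphisms.projectiveSpaceInt κ))) (unitModule _) 1 ≅ N₂) :
    Nonempty (twistMod (((Over.homMk j₁ hj₁ ⊗ₘ Over.homMk j₂ hj₂ :
          Y₁ ⊗ Y₂ ⟶ Over.mk (Morphisms.projectiveSpaceFst ι Y) ⊗ Over.mk (Morphisms.projectiveSpaceFst κ Y)) ≫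
          Morphisms.segreOver Y ε).left ≫ pullback.snd (terminal.from Y) (terminal.from (Morphisms.projectiveSpaceInt τ)))
        (unitModule _) 1 ≅
      tensorObj ((Scheme.Modules.pullback (pullback.fst Y₁.hom Y₂.hom)).obj N₁)
        ((Scheme.Modules.pullback (pullback.snd Y₁.hom Y₂.hom)).obj N₂)) := by
  have e₁ := detClass_eq_of_iso ψ₁ (isFiniteLocallyFree_twistMod_unitModule _ 1) (HasRank.isFiniteLocallyFree' hN₁)
  have e₂ := detClass_eq_of_iso ψ₂ (isFiniteLocallyFree_twistMod_unitModule _ 1) (HasRank.isFiniteLocallyFree' hN₂)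
  refine (nonempty_iso_iff_detClass_eq (hasRank_twistMod_unitModule _ 1)
    (hasRank_tensorObj_one (hasRank_pullback _ hN₁) (hasRank_pullback _ hN₂)) (isFiniteLocallyFree_twistMod_unitModule _ 1)
    (isFiniteLocallyFree_tensorObj _ _ ((HasRank.isFiniteLocallyFree' hN₁).pullback _)
      ((HasRank.isFiniteLocallyFree' hN₂).pullback _))).2 ?_
  rw [detClass_twistMod_prodSegre, detClass_tensorObj_of_hasRank_one (hasRank_pullback _ hN₁) (hasRank_pullback _ hN₂)
    ((HasRank.isFiniteLocallyFree' hN₁).pullback _) ((HasRank.isFiniteLocallyFree' hN₂).pullback _),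
    detClass_pullback (hE := HasRank.isFiniteLocallyFree' hN₁), detClass_pullback (hE := HasRank.isFiniteLocallyFree' hN₂), e₁, e₂]
  rfl

end SerreTwist

end Literature.AlgebraicGeometry.Modules

end
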